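/-
Copyright (c) 2026. All rights reserved.
Released under Apache 2.0 license as described in the file LICENSE.
Authors: abc-iut cell, prover seat abc-iut-w5-d017 (wave 5, gen 5).
-/
import Literature.IUT.LogVolume.UnitLogRamificationCriterion
import HarnessLib

/-!
# Dyadic places with `2 ∣ e` and residue degree `f ≥ 2`: a unit with a unit `2`-adic logarithm

Proof-only companion (theorems, no definitions) of abc-iut-w5-d172's `UnitLogWildDyadic.lean`
(`e(K/ℚ₂) = 2`, `f(K/ℚ₂) = 1` ⇒ `log₂(𝒪_K^×) ⊆ 𝔪_K`: the terms of index `2` and `4` of the logarithmic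
series CANCEL modulo `𝔪`) and of abc-iut-w5-d017's `UnitLogRamificationCriterion.lean` (odd `p`:
`log_p(𝒪_K^×)` meets `𝒪_K^×` iff `p ∣ e`; every `p`: `p ∤ e` ⇒ it does not).  At `p = 2` with `2 ∣ e = 2k`
the exponent sequence `h(a) = k·2^a − 2k·a` of `LogSeriesDominantTerm.lean` has the TWO minimisers
`a = 1, 2` (`h(1) = h(2) = 0`, all other indices `≥ 1`), so for `‖1 − y‖ = ‖ϖ‖^k` the norm of
`L(y) = −Σ (1−y)ⁿ/n` is decided by the pair `x²/2 + x⁴/4 = w·(1 + w)`, `w = x²/2` a unit (`x = 1 − y`):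
`‖L(y)‖ = ‖1 + w‖` if this is `1`, and in any case `‖L(y) + w(1+w)‖ < 1` (`norm_logSeries_eq_one_of_pair`).
Whether some unit `u` makes `1 + w₀u²` a unit (`w₀ = ϖ^{2k}/2`) is a residue-field question: if NOT, then
`u² ≡ 1`, i.e. `u ≡ 1 (mod 𝔪)` for EVERY unit `u` (`2 ∈ 𝔪`), i.e. the residue field is `𝔽₂`
(`exists_norm_one_add_mul_sq_eq_one`).  Hence:

* `exists_norm_unitLog_eq_one_of_two_dvd` — **`2 ∣ e(K/ℚ₂)` and `f(K/ℚ₂) ≥ 2` ⇒ some unit of `𝒪_K` has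
  a UNIT logarithm**, `log₂(𝒪_K^×)` meets the unit sphere (`logUnits_inter_sphere_nonempty_of_two_dvd`);
* with `RamificationCriterion.norm_unitLog_ne_one_of_not_dvd` (`e` odd ⇒ never):
  **for `f ≥ 2`, `log₂(𝒪_K^×)` meets `𝒪_K^×` iff `2 ∣ e(K/ℚ₂)`**
  (`logUnits_inter_sphere_nonempty_iff_two_dvd_of_two_le_residueDegree`).

Left open by design: `p = 2`, `2 ∣ e`, `f = 1` beyond `e = 2` (`UnitLogWildDyadic`: empty at `e = 2`).
Classical (Neukirch, *Algebraic Number Theory* II (5.5)).  Relevance to the cell: in [IUTchI] Def. 3.1 the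
field `F` contains `√−1`, so EVERY place of `F` over `2` has even `e(v|2)`; by this file the honest
depth-`2` (Ind3) image at such a place is inhabited as soon as `f(v|2) ≥ 2`.  Nothing here is disputed
mathematics; no IUT statement is asserted; nothing bears on [IUTchIII] Cor. 3.12.
-/

noncomputable section

open Metric Set IsLocalRing

namespace Literature.IUT.LogVolume

namespace RamificationCriterion

open Literature.NumberTheory.GaloisRepresentations.Ultrametric

/-! ### §1. Residue fields with more than two elements: a unit `u` with `u ≢ 1` -/

section Residue

open scoped NormedField

variable (p : ℕ) [hp : Fact p.Prime]
variable {K : Type*} [NontriviallyNormedField K] [instK : NormedAlgebra ℚ_[p] K] [IsUltrametricDist K]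
  [ProperSpace K]

/-- **If the residue field has more than two elements there is a unit `u` with `‖u − 1‖ = 1`** (a unit
which is not a principal unit: lift a residue class `≠ 0, 1`). [cite: NeukirchANT1999, Ch. II (5.3)] -/
theorem exists_norm_eq_one_and_norm_sub_one_eq_one
    (hcard : 2 < Nat.card (ResidueField (Valued.integer K))) :
    ∃ u : K, ‖u‖ = 1 ∧ ‖u - 1‖ = 1 := by
  haveI : Finite (ResidueField (Valued.integer K)) := finite_residueField
  classical
  -- a residue class other than `0` and `1` (pigeonhole on three distinct classes)
  obtain ⟨z, hz0, hz1⟩ : ∃ z : ResidueField (Valued.integer K), z ≠ 0 ∧ z ≠ 1 := by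
    letI : Fintype (ResidueField (Valued.integer K)) := Fintype.ofFinite _
    rw [Nat.card_eq_fintype_card] at hcard
    obtain ⟨a, b, c, hab, hac, hbc⟩ := Fintype.two_lt_card_iff.mp hcard
    by_contra hne
    simp only [not_exists, not_and, ne_eq, Decidable.not_not] at hne
    have key : ∀ z : ResidueField (Valued.integer K), z = 0 ∨ z = 1 := fun z ↦ by
      by_cases hz : z = 0
      · exact Or.inl hz
      · exact Or.inr (hne z hz)
    rcases key a with rfl | rfl <;> rcases key b with rfl | rfl <;> rcases key c with rfl | rfl
    all_goals first
      | exact hab rfl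
      | exact hac rfl
      | exact hbc rfl
  obtain ⟨a, rfl⟩ := Ideal.Quotient.mk_surjective z
  have ha0 : a ∉ maximalIdeal (Valued.integer K) := fun h ↦ hz0 (Ideal.Quotient.eq_zero_iff_mem.mpr h)
  have ha1 : a - 1 ∉ maximalIdeal (Valued.integer K) := fun h ↦ hz1 (by
    have : Ideal.Quotient.mk (maximalIdeal (Valued.integer K)) (a - 1) = 0 :=
      Ideal.Quotient.eq_zero_iff_mem.mpr h
    rwa [map_sub, map_one, sub_eq_zero] at this)
  rw [mem_maximalIdeal_iff_norm_lt_one] at ha0 ha1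
  have hale : ‖(a : K)‖ ≤ 1 := a.2
  have ha : ‖(a : K)‖ = 1 := le_antisymm hale (not_lt.mp ha0)
  refine ⟨(a : K), ha, le_antisymm ?_ (not_lt.mp ?_)⟩
  · calc ‖(a : K) - 1‖ ≤ max ‖(a : K)‖ ‖(1 : K)‖ := by
          simpa only [sub_eq_add_neg, norm_neg] using IsUltrametricDist.norm_add_le_max (a : K) (-1)
      _ = 1 := by rw [ha, norm_one, max_self]
  · change ¬ ‖((a - 1 : Valued.integer K) : K)‖ < 1 at ha1
    push_cast at ha1
    exact ha1

/-- … in particular when the residue degree is `≥ 2` (`#(𝒪/𝔪) = p^f ≥ p² > 2`).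
[cite: NeukirchANT1999, Ch. II (5.3)] -/
theorem exists_norm_eq_one_and_norm_sub_one_eq_one_of_two_le_residueDegree
    (hf : 2 ≤ residueDegree p K) : ∃ u : K, ‖u‖ = 1 ∧ ‖u - 1‖ = 1 := by
  refine exists_norm_eq_one_and_norm_sub_one_eq_one ?_
  rw [card_residueField p K]
  have hp2 : 2 ≤ p := hp.out.two_le
  calc 2 < 2 ^ 2 := by norm_num
    _ ≤ p ^ 2 := Nat.pow_le_pow_left hp2 2
    _ ≤ p ^ residueDegree p K := Nat.pow_le_pow_right hp.out.pos hf

end Residue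

/-! ### §2. The residue-field dichotomy at `2`: some `1 + w₀·u²` is a unit -/

section Dichotomy

variable {K : Type*} [NontriviallyNormedField K] [IsUltrametricDist K]

/-- **If `‖2‖ < 1`, `‖w₀‖ = 1` and some unit is not principal, then `‖1 + w₀·u²‖ = 1` for some unit `u`.**
Otherwise `1 + w₀ ∈ 𝔪` and `1 + w₀u² ∈ 𝔪` give `u² − 1 = (u−1)(u+1) ∈ 𝔪`, and `u + 1 = (u − 1) + 2`, so
`u ≡ 1 (mod 𝔪)` — for every unit `u`. [cite: NeukirchANT1999, Ch. II (5.5)] -/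
theorem exists_norm_one_add_mul_sq_eq_one (h2 : ‖(2 : K)‖ < 1) {w₀ : K} (hw₀ : ‖w₀‖ = 1)
    (hu : ∃ u : K, ‖u‖ = 1 ∧ ‖u - 1‖ = 1) : ∃ u : K, ‖u‖ = 1 ∧ ‖1 + w₀ * u ^ 2‖ = 1 := by
  have hsub : ∀ a b : K, ‖a - b‖ ≤ max ‖a‖ ‖b‖ := fun a b ↦ by
    simpa only [sub_eq_add_neg, norm_neg] using IsUltrametricDist.norm_add_le_max a (-b)
  have hle : ∀ u : K, ‖u‖ = 1 → ‖1 + w₀ * u ^ 2‖ ≤ 1 := fun u hu ↦ by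
    calc ‖1 + w₀ * u ^ 2‖ ≤ max ‖(1 : K)‖ ‖w₀ * u ^ 2‖ := IsUltrametricDist.norm_add_le_max _ _
      _ = 1 := by rw [norm_one, norm_mul, norm_pow, hw₀, hu, one_pow, mul_one, max_self]
  by_cases h1 : ‖1 + w₀ * 1 ^ 2‖ = 1
  · exact ⟨1, norm_one, h1⟩
  obtain ⟨u, hu1, hu2⟩ := hu
  refine ⟨u, hu1, ?_⟩
  by_contra hne
  have hlt1 : ‖1 + w₀ * 1 ^ 2‖ < 1 := lt_of_le_of_ne (hle 1 norm_one) h1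
  have hltu : ‖1 + w₀ * u ^ 2‖ < 1 := lt_of_le_of_ne (hle u hu1) hne
  -- `‖w₀ (u² - 1)‖ < 1`
  have hdiff : ‖w₀ * (u ^ 2 - 1)‖ < 1 := by
    have : w₀ * (u ^ 2 - 1) = (1 + w₀ * u ^ 2) - (1 + w₀ * 1 ^ 2) := by ring
    rw [this]
    exact (hsub _ _).trans_lt (max_lt hltu hlt1)
  rw [norm_mul, hw₀, one_mul, show u ^ 2 - 1 = (u - 1) * (u + 1) by ring, norm_mul, hu2, one_mul]
    at hdiff
  -- but `u - 1 = (u + 1) - 2` has norm `< 1` then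
  have : ‖u - 1‖ < 1 := by
    rw [show u - 1 = (u + 1) - 2 by ring]
    exact (hsub _ _).trans_lt (max_lt hdiff h2)
  rw [hu2] at this
  exact lt_irrefl _ this

end Dichotomy

/-! ### §3. `p = 2`, `e = 2k`: the pair of indices `2, 4` decides `‖L(y)‖` -/

section Dyadic

variable {K : Type*} [NontriviallyNormedField K] [instK : NormedAlgebra ℚ_[2] K] [IsUltrametricDist K]
  [ProperSpace K]

/-- `2a + 1 ≤ 2^a` for `a ≥ 3`. [folklore] -/
private theorem two_mul_add_one_le_two_pow {a : ℕ} (ha : 3 ≤ a) : 2 * a + 1 ≤ 2 ^ a := by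
  obtain ⟨d, rfl⟩ := Nat.exists_eq_add_of_le ha
  induction d with
  | zero => norm_num
  | succ d ih =>
    rw [show 3 + (d + 1) = 3 + d + 1 from rfl, pow_succ]
    omega

/-- **The exponents at `p = 2`, `e = 2k`**: every index other than `2` and `4` has exponent `≥ k (≥ 1)`:
`N(n) = k·n − 2k·v₂(n) ≥ k` for `n ∉ {2, 4}`. [cite: NeukirchANT1999, Ch. II (5.5)] -/
theorem exponent_ge_of_ne_two_four {k : ℕ} (hk : 1 ≤ k) {n : ℕ} (hn : n ≠ 0) (h2 : n ≠ 2) (h4 : n ≠ 4) :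
    (1 : ℤ) ≤ (k : ℤ) * (n : ℤ) - ((2 * k : ℕ) : ℤ) * (padicValNat 2 n : ℤ) := by
  have hS : (1 : ℤ) ≤ (k : ℤ) := by exact_mod_cast hk
  obtain ⟨a, ha, ha'⟩ := exists_exponent_le_index (p := 2) hS (2 * k) hn
  -- `h(a) = k·2^a − 2k·a`
  rcases Nat.lt_or_ge a 3 with hlt | hge
  · interval_cases a
    · -- `a = 0`: `h(0) = k`
      simp only [pow_zero, mul_one, Nat.cast_zero, mul_zero, sub_zero] at ha
      push_cast at ha ⊢
      linarith
    · -- `a = 1`: `n ≠ 2 = 2^1`, so `N ≥ h(1) + 1 = 1`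
      have := ha' (by simpa using h2)
      push_cast at this ⊢
      linarith
    · -- `a = 2`: `n ≠ 4 = 2^2`
      have := ha' (by simpa using h4)
      push_cast at this ⊢
      linarith
  · -- `a ≥ 3`: `h(a) = k (2^a − 2a) ≥ k`
    have hpow : ((2 * a + 1 : ℕ) : ℤ) ≤ ((2 ^ a : ℕ) : ℤ) := by
      exact_mod_cast two_mul_add_one_le_two_pow hge
    push_cast at ha hpow ⊢
    have hk0 : (0 : ℤ) ≤ (k : ℤ) := by positivity
    nlinarith

/-- **`p = 2`, `e(K/ℚ₂) = 2k`, `x = 1 − y` with `‖x‖ = ‖ϖ‖^k`, and `1 + x²/2` a unit ⇒ `‖L(y)‖ = 1`**: the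
terms of index `2` and `4` sum to `−(x²/2)(1 + x²/2)`, a unit, and all other terms have norm `≤ ‖ϖ‖`.
[cite: NeukirchANT1999, Ch. II (5.5)] -/
theorem norm_logSeries_eq_one_of_pair {ϖ : Kˣ} (hϖ : IsUniformizer ϖ) {k : ℕ}
    (hk : absRamificationIdx 2 K = 2 * k) {y : K} (hy : ‖1 - y‖ = ‖(ϖ : K)‖ ^ (k : ℤ))
    (hunit : ‖1 + (1 - y) ^ 2 / 2‖ = 1) : ‖logSeries y‖ = 1 := by
  classical
  have hρ0 : 0 < ‖(ϖ : K)‖ := norm_units_pos ϖ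
  have he1 : 1 ≤ absRamificationIdx 2 K := absRamificationIdx_pos 2 K
  have hk1 : 1 ≤ k := by omega
  have hyP : IsPrincipal y := by
    show ‖1 - y‖ < 1
    rw [hy]
    exact zpow_lt_one₀ hρ0 hϖ.1 (by exact_mod_cast hk1)
  set x : K := 1 - y with hx
  -- `‖2‖ = ‖ϖ‖^{2k}` and `‖x²/2‖ = 1`
  have h2 : ‖(2 : K)‖ = ‖(ϖ : K)‖ ^ (2 * k) := by
    have := norm_prime_eq_norm_pow 2 K hϖ
    rw [hk] at this
    exact_mod_cast this
  have h20 : (2 : K) ≠ 0 := by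
    intro h; rw [h, norm_zero] at h2; exact (pow_pos hρ0 _).ne h2
  have hx2 : ‖x ^ 2 / 2‖ = 1 := by
    rw [norm_div, norm_pow, hy, h2, ← zpow_natCast, ← zpow_natCast, ← zpow_mul, div_eq_one_iff_eq
      (zpow_pos hρ0 _).ne']
    congr 1
    push_cast
    ring
  -- the series and its two special terms
  set f : ℕ → K := fun n ↦ -((1 - y) ^ (n + 1)) / (n + 1 : K) with hf
  have hsum : HasSum f (logSeries y) := hasSum_logSeries 2 hyP
  have hsum1 := hasSum_ite_sub_hasSum hsum 1
  have hsum2 := hasSum_ite_sub_hasSum hsum1 3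
  have hf1 : f 1 = -(x ^ 2 / 2) := by
    rw [hf]; dsimp only; rw [hx]; norm_num [neg_div]
  have hf3 : (fun n ↦ if n = 1 then (0 : K) else f n) 3 = -(x ^ 4 / 4) := by
    simp only [show (3 : ℕ) ≠ 1 by decide, if_false, hf, hx]
    norm_num [neg_div]
  have hpair : f 1 + (fun n ↦ if n = 1 then (0 : K) else f n) 3 = -(x ^ 2 / 2 * (1 + x ^ 2 / 2)) := by
    rw [hf1, hf3]
    have h4 : (4 : K) = 2 * 2 := by norm_num
    rw [h4]
    field_simp
    ring
  -- the rest is small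
  have hrest : ‖logSeries y - f 1 - (fun n ↦ if n = 1 then (0 : K) else f n) 3‖ ≤ ‖(ϖ : K)‖ := by
    rw [← hsum2.tsum_eq]
    refine IsUltrametricDist.norm_tsum_le_of_forall_le_of_nonneg (norm_nonneg _) fun n ↦ ?_
    by_cases hn3 : n = 3
    · simp only [hn3, if_true, norm_zero]; exact norm_nonneg _
    by_cases hn1 : n = 1
    · simp only [hn1, if_true, show (1 : ℕ) ≠ 3 by decide, if_false, norm_zero]; exact norm_nonneg _
    simp only [hn3, hn1, if_false]
    rw [hf]
    dsimp only
    rw [norm_logTerm_eq_zpow 2 hϖ hy n]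
    calc ‖(ϖ : K)‖ ^ ((k : ℤ) * ((n + 1 : ℕ) : ℤ)
          - (absRamificationIdx 2 K : ℤ) * (padicValNat 2 (n + 1) : ℤ))
        ≤ ‖(ϖ : K)‖ ^ (1 : ℤ) := by
          refine zpow_le_zpow_right_of_le_one₀ hρ0 hϖ.1.le ?_
          rw [hk]
          exact exponent_ge_of_ne_two_four hk1 (Nat.succ_ne_zero n) (by omega) (by omega)
      _ = ‖(ϖ : K)‖ := zpow_one _
  have hdom : ‖f 1 + (fun n ↦ if n = 1 then (0 : K) else f n) 3‖ = 1 := by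
    rw [hpair, norm_neg, norm_mul, hx2, one_mul, hunit]
  have hsplit : logSeries y = (f 1 + (fun n ↦ if n = 1 then (0 : K) else f n) 3)
      + (logSeries y - f 1 - (fun n ↦ if n = 1 then (0 : K) else f n) 3) := by ring
  have hlt : ‖logSeries y - f 1 - (fun n ↦ if n = 1 then (0 : K) else f n) 3‖
      < ‖f 1 + (fun n ↦ if n = 1 then (0 : K) else f n) 3‖ := by
    rw [hdom]; exact hrest.trans_lt hϖ.1
  rw [hsplit, IsUltrametricDist.norm_add_eq_max_of_norm_ne_norm (ne_of_gt hlt), max_eq_left hlt.le, hdom]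

/-- **`2 ∣ e(K/ℚ₂)`, `f(K/ℚ₂) ≥ 2` ⇒ there is a unit of `𝒪_K` whose `2`-adic logarithm is a unit**:
`y = 1 − ϖ^k·u` with `u` a unit making `1 + (ϖ^{2k}/2)·u²` a unit (§2, §1).
[cite: NeukirchANT1999, Ch. II (5.5)] -/
theorem exists_norm_unitLog_eq_one_of_two_dvd (he : 2 ∣ absRamificationIdx 2 K)
    (hf : 2 ≤ residueDegree 2 K) : ∃ u : K, ‖u‖ = 1 ∧ ‖unitLog u‖ = 1 := by
  obtain ⟨k, hk⟩ := he
  obtain ⟨ϖ, hϖ⟩ := exists_isUniformizer (F := K)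
  have hρ0 : 0 < ‖(ϖ : K)‖ := norm_units_pos ϖ
  have hk1 : 1 ≤ k := by have := absRamificationIdx_pos 2 K; omega
  have h2 : ‖(2 : K)‖ = ‖(ϖ : K)‖ ^ (2 * k) := by
    have := norm_prime_eq_norm_pow 2 K hϖ
    rw [hk] at this
    exact_mod_cast this
  have h2lt : ‖(2 : K)‖ < 1 := by exact_mod_cast norm_prime_lt_one 2 K
  have h20 : (2 : K) ≠ 0 := by
    intro h; rw [h, norm_zero] at h2; exact (pow_pos hρ0 _).ne h2
  -- `w₀ = ϖ^{2k}/2` is a unit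
  have hw₀ : ‖(ϖ : K) ^ (2 * k) / 2‖ = 1 := by
    rw [norm_div, norm_pow, h2, div_self (pow_pos hρ0 _).ne']
  obtain ⟨u, hu, hunit⟩ := exists_norm_one_add_mul_sq_eq_one h2lt hw₀
    (exists_norm_eq_one_and_norm_sub_one_eq_one_of_two_le_residueDegree 2 hf)
  -- `y = 1 − ϖ^k u`
  set x : K := (ϖ : K) ^ k * u with hx
  have hxn : ‖1 - (1 - x)‖ = ‖(ϖ : K)‖ ^ (k : ℤ) := by
    rw [sub_sub_cancel, hx, norm_mul, norm_pow, hu, mul_one, zpow_natCast]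
  have hx2 : 1 + (1 - (1 - x)) ^ 2 / 2 = 1 + (ϖ : K) ^ (2 * k) / 2 * u ^ 2 := by
    rw [sub_sub_cancel, hx]; ring
  have hyP : IsPrincipal (1 - x) := by
    show ‖1 - (1 - x)‖ < 1
    rw [hxn]
    exact zpow_lt_one₀ hρ0 hϖ.1 (by exact_mod_cast hk1)
  refine ⟨1 - x, hyP.norm_eq_one, ?_⟩
  rw [unitLog_of_isPrincipal 2 hyP]
  exact norm_logSeries_eq_one_of_pair hϖ hk hxn (by rw [hx2]; exact hunit)

/-- **`2 ∣ e`, `f ≥ 2` ⇒ `log₂(𝒪_K^×)` meets the unit sphere.** [cite: NeukirchANT1999, Ch. II (5.5)] -/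
theorem logUnits_inter_sphere_nonempty_of_two_dvd (he : 2 ∣ absRamificationIdx 2 K)
    (hf : 2 ≤ residueDegree 2 K) : (logUnits K ∩ sphere 0 1).Nonempty := by
  obtain ⟨u, hu, hlog⟩ := exists_norm_unitLog_eq_one_of_two_dvd he hf
  exact ⟨unitLog u, unitLog_mem_logUnits hu, mem_sphere_zero_iff_norm.mpr hlog⟩

/-- **`2 ∣ e`, `f ≥ 2` ⇒ `log₂(𝒪_K^×) ⊄ 𝔪_K`** — contrast with `UnitLogWildDyadic` (`e = 2`, `f = 1`: `⊆ 𝔪_K`).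
[cite: NeukirchANT1999, Ch. II (5.5)] -/
theorem not_logUnits_subset_ball_of_two_dvd (he : 2 ∣ absRamificationIdx 2 K)
    (hf : 2 ≤ residueDegree 2 K) : ¬ logUnits K ⊆ ball 0 1 := by
  obtain ⟨z, hz, hz1⟩ := logUnits_inter_sphere_nonempty_of_two_dvd he hf
  intro h
  have := h hz
  rw [mem_ball_zero_iff, mem_sphere_zero_iff_norm.mp hz1] at this
  exact lt_irrefl _ this

/-- … and the "second iterate" of `log₂` on units has inhabited domain. [cite: NeukirchANT1999, Ch. II (5.5)] -/
theorem unitLog_image_logUnits_inter_sphere_nonempty_of_two_dvd (he : 2 ∣ absRamificationIdx 2 K)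
    (hf : 2 ≤ residueDegree 2 K) : (unitLog '' (logUnits K ∩ sphere 0 1)).Nonempty :=
  (logUnits_inter_sphere_nonempty_of_two_dvd he hf).image _

/-- **THE DYADIC CRITERION for `f ≥ 2`**: `log₂(𝒪_K^×)` meets `𝒪_K^×` iff `2 ∣ e(K/ℚ₂)` (the "only if" is
`RamificationCriterion.logUnits_inter_sphere_eq_empty_of_not_dvd`, valid for every `f`).
[cite: NeukirchANT1999, Ch. II (5.5)] -/
theorem logUnits_inter_sphere_nonempty_iff_two_dvd_of_two_le_residueDegree (hf : 2 ≤ residueDegree 2 K) :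
    (logUnits K ∩ sphere 0 1).Nonempty ↔ 2 ∣ absRamificationIdx 2 K := by
  refine ⟨fun h ↦ ?_, fun he ↦ logUnits_inter_sphere_nonempty_of_two_dvd he hf⟩
  by_contra he
  rw [logUnits_inter_sphere_eq_empty_of_not_dvd 2 he] at h
  exact Set.not_nonempty_empty h

/-- … equivalently `∃ u, ‖u‖ = 1 ∧ ‖log₂ u‖ = 1 ⟺ 2 ∣ e(K/ℚ₂)`, for `f ≥ 2`.
[cite: NeukirchANT1999, Ch. II (5.5)] -/
theorem exists_norm_unitLog_eq_one_iff_two_dvd_of_two_le_residueDegree (hf : 2 ≤ residueDegree 2 K) :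
    (∃ u : K, ‖u‖ = 1 ∧ ‖unitLog u‖ = 1) ↔ 2 ∣ absRamificationIdx 2 K :=
  ⟨fun ⟨_, _, hu⟩ ↦ dvd_absRamificationIdx_of_norm_unitLog_eq_one 2 hu,
    fun he ↦ exists_norm_unitLog_eq_one_of_two_dvd he hf⟩

end Dyadic

end RamificationCriterion

end Literature.IUT.LogVolume

end
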